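import Literature.NumberTheory.Transcendental.KZProductIdeal
import Literature.NumberTheory.Transcendental.KZDirichletCharts
import Literature.NumberTheory.Transcendental.KZDirichletPeeling
import Literature.NumberTheory.Transcendental.KZCalculusProofs
import HarnessLib

/-!
# A proved rung of `RootDecompQuadraticDescent.QuadraticDescent`: Dirichlet's Beta-product identity
between KZ-RATIONAL planar regions

Support file (Theorems-shaped, import-free of route files; cell decomp-kz, lens 6, gen 3) for the crux
`Summit.KontsevichZagierPeriods.KontsevichZagierPeriods.Theses.RootDecompQuadraticDescent.QuadraticDescent`
(item stmt-KontsevichZagierPeriods-26540, route route-KontsevichZagierPeriods-RootDecompQuadraticDescent):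
the first two-monomial instance of its product layer (`productDescent_of_quadraticDescent`, `d = 3`,
`R = KZ.relations`) CLOSED OUTRIGHT for KZ-rational data — the BC5 witness of weakness / T3 first rung.

For rationals `a, b, c > 0` and ANY representations `B₁ = β(a+b,c)`, `B₂ = β(a,b)`, `B₃ = β(b,c)`,
`B₄ = β(a,b+c)` pinned as Euler integrals `[(0,1), t^{p-1}(1-t)^{q-1}]` (`KZ.exists_betaRep'`), with
`Gᵢ := Bᵢ.graphRep` their volume-under-the-graph representations (dimension 2, polynomial integrand,
`ℚ`-semialgebraic band: `KZ.IntegralRep.isRational_graphRep`):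
* `dirichlet_pinned_mem_relations` — `[B₁]·[B₂] − [B₃]·[B₄] ∈ KZ.relations` (Fubini `KZ.of_mul_of` + the two
  Dirichlet charts `KZ.dirichletPolar_equivalent`, `KZ.dirichletLinear_equivalent`);
* `dirichlet_graphRegions_mem_relations` — `[G₁]·[G₂] − [G₃]·[G₄] ∈ KZ.relations` (four Newton–Leibniz
  moves `equivalent_graphRep` + the PROVED two-sided ideal property `KZ.mul_sub_mul_mem_relations`);
* `pinned_value`, `graphRegion_value` — the areas are `B(p,q) = Γ(p)Γ(q)/Γ(p+q)`;
* `quadraticDescent_rung` — the element is a generators-built input of `QuadraticDescent 3` (products of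
  KZ-rational representations of dimensions `2, 2 ≤ 3`, `2+2 ≤ 3+1`), has value `0`, and lies in every
  `R ⊇ KZ.relations` with NO coincidence hypothesis;
* `rung_specimen` — `a = 3/2, b = 4/3, c = 5/4`: four KZ-rational planar regions of areas `B(17/6,5/4)`,
  `B(3/2,4/3)`, `B(4/3,5/4)`, `B(3/2,31/12)` (pairwise distinct Beta classes, non-integral parameter sums,
  transcendental values — Schneider 1941) with `[G₁]·[G₂] − [G₃]·[G₄] ∈ KZ.relations`: an equality of
  4-dimensional KZ-rational volumes realised inside rules 1)–3), outside the proved regimes of Conjecture 1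
  (dimension ≤ 1, Baker; rational-valued polynomial boxes; the cell span `V`).
Everything proved; standard axioms; no `def`.

PLACEMENT (cell critic decomp-kz-crit-1, 2026-08-30T03:28:30Z, probe `critic_rung_dischargeable_from_QD_hyps`):
as a `QuadraticDescent 3` input this element is dischargeable from the coincidence hypothesis `hC` via the
3-dimensional graph regions of `B₁ × B₂`, `B₃ × B₄` (`graphRep` of the products: KZ-rational, dimension 3,
equal volumes); its content is the move-realisation of a dimension-3/4 KZ-rational COINCIDENCE, i.e. a
proved instance of the conclusion layer of `DescentThreeQ` (stmt-KontsevichZagierPeriods-26541) /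
`DescentThree` (stmt-KontsevichZagierPeriods-24769) at `R = KZ.relations`, outside the proved regimes of
Conjecture 1 — which is where this file is filed (`--supports stmt-KontsevichZagierPeriods-26541`).
References: Kontsevich–Zagier 2001 §1.1–1.2, §4.1; Andrews–Askey–Roy 1999, Thm 1.8.1 (Dirichlet).
-/

noncomputable section

namespace Summit.KontsevichZagierPeriods.KontsevichZagierPeriods.Theorems

open Literature.NumberTheory.Transcendental
open Set MeasureTheory

namespace RootDecompQuadraticDescentRung

open Literature.NumberTheory.Transcendental.KZ

/-- STEP 1 (inside the rules, for PINNED Beta representations): Dirichlet's re-association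
`[β(a+b,c)]·[β(a,b)] − [β(b,c)]·[β(a,b+c)] ∈ KZ.relations` — Fubini (`KZ.of_mul_of`) and the two
Dirichlet charts of the simplex (`KZ.dirichletPolar_equivalent`, `KZ.dirichletLinear_equivalent`). -/
theorem dirichlet_pinned_mem_relations (a b c : ℚ) (B₁ B₂ B₃ B₄ : KZ.IntegralRep 1)
    (h₁d : B₁.domain = {t | t 0 ∈ Set.Ioo (0:ℝ) 1})
    (h₁i : Set.EqOn B₁.integrand (fun t => (t 0) ^ (((a + b : ℚ) : ℝ) - 1) * (1 - t 0) ^ ((c : ℝ) - 1)) B₁.domain)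
    (h₂d : B₂.domain = {t | t 0 ∈ Set.Ioo (0:ℝ) 1})
    (h₂i : Set.EqOn B₂.integrand (fun t => (t 0) ^ ((a : ℝ) - 1) * (1 - t 0) ^ ((b : ℝ) - 1)) B₂.domain)
    (h₃d : B₃.domain = {t | t 0 ∈ Set.Ioo (0:ℝ) 1})
    (h₃i : Set.EqOn B₃.integrand (fun t => (t 0) ^ ((b : ℝ) - 1) * (1 - t 0) ^ ((c : ℝ) - 1)) B₃.domain)
    (h₄d : B₄.domain = {t | t 0 ∈ Set.Ioo (0:ℝ) 1})
    (h₄i : Set.EqOn B₄.integrand (fun t => (t 0) ^ ((a : ℝ) - 1) * (1 - t 0) ^ (((b + c : ℚ) : ℝ) - 1)) B₄.domain) :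
    KZ.of B₁ * KZ.of B₂ - KZ.of B₃ * KZ.of B₄ ∈ KZ.relations := by
  have e0 : (Fin.castAdd 1 (0 : Fin 1) : Fin 2) = 0 := rfl
  have e1 : (Fin.natAdd 1 (0 : Fin 1) : Fin 2) = 1 := rfl
  set P := B₁.prod B₂ with hP
  set B := B₃.prod B₄ with hB
  have hPd : P.domain = {z : Fin 2 → ℝ | z 0 ∈ Set.Ioo (0:ℝ) 1 ∧ z 1 ∈ Set.Ioo (0:ℝ) 1} := by
    ext z
    simp only [hP, IntegralRep.prod_domain, IntegralRep.mem_prodDomain, h₁d, h₂d, mem_setOf_eq, e0, e1]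
  have hPi : Set.EqOn P.integrand (fun z => (z 0) ^ ((a : ℝ) + b - 1) * (1 - z 0) ^ ((c : ℝ) - 1) *
      ((z 1) ^ ((a : ℝ) - 1) * (1 - z 1) ^ ((b : ℝ) - 1))) P.domain := by
    intro z hz
    have hz' : (fun i => z (Fin.castAdd 1 i)) ∈ B₁.domain ∧ (fun j => z (Fin.natAdd 1 j)) ∈ B₂.domain := by
      simpa only [hP, IntegralRep.prod_domain, IntegralRep.mem_prodDomain] using hz
    rw [hP, IntegralRep.prod_integrand_eq, IntegralRep.prodFun_apply, h₁i hz'.1, h₂i hz'.2]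
    simp only [e0, e1]
    push_cast
    ring_nf
  obtain ⟨S, hSd, hSi, hPS⟩ := dirichletPolar_equivalent a b c P hPd hPi
  have hBd : B.domain = {z : Fin 2 → ℝ | z 0 ∈ Set.Ioo (0:ℝ) 1 ∧ z 1 ∈ Set.Ioo (0:ℝ) 1} := by
    ext z
    simp only [hB, IntegralRep.prod_domain, IntegralRep.mem_prodDomain, h₃d, h₄d, mem_setOf_eq, e0, e1]
  have hBi : Set.EqOn B.integrand (fun z => (z 0) ^ ((b : ℝ) - 1) * (1 - z 0) ^ ((c : ℝ) - 1) *
      ((z 1) ^ ((a : ℝ) - 1) * (1 - z 1) ^ ((b : ℝ) + c - 1))) B.domain := by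
    intro z hz
    have hz' : (fun i => z (Fin.castAdd 1 i)) ∈ B₃.domain ∧ (fun j => z (Fin.natAdd 1 j)) ∈ B₄.domain := by
      simpa only [hB, IntegralRep.prod_domain, IntegralRep.mem_prodDomain] using hz
    rw [hB, IntegralRep.prod_integrand_eq, IntegralRep.prodFun_apply, h₃i hz'.1, h₄i hz'.2]
    simp only [e0, e1]
    push_cast
    ring_nf
  have hSB : Equivalent S B := dirichletLinear_equivalent a b c S B hSd hSi hBd hBi
  rw [of_mul_of, of_mul_of]
  have e : of (B₁.prod B₂) - of (B₃.prod B₄) = (of P - of S) + (of S - of B) := by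
    rw [hP, hB]; abel
  rw [e]
  exact relations.add_mem hPS hSB

/-- STEP 2 (transport to KZ-RATIONAL planar regions): the volume-under-the-graph representations
`Gᵢ := Bᵢ.graphRep` (dimension 2, integrand a coordinate, domain a `ℚ`-semialgebraic band — KZ's
literal rational shape, `KZ.IntegralRep.isRational_graphRep`; one Newton–Leibniz move each,
`KZ.IntegralRep.equivalent_graphRep`) satisfy the same quadratic relation, by the PROVED two-sided
ideal property of `KZ.relations` (`KZ.mul_sub_mul_mem_relations`). -/
theorem dirichlet_graphRegions_mem_relations (a b c : ℚ) (B₁ B₂ B₃ B₄ : KZ.IntegralRep 1)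
    (h₁d : B₁.domain = {t | t 0 ∈ Set.Ioo (0:ℝ) 1})
    (h₁i : Set.EqOn B₁.integrand (fun t => (t 0) ^ (((a + b : ℚ) : ℝ) - 1) * (1 - t 0) ^ ((c : ℝ) - 1)) B₁.domain)
    (h₂d : B₂.domain = {t | t 0 ∈ Set.Ioo (0:ℝ) 1})
    (h₂i : Set.EqOn B₂.integrand (fun t => (t 0) ^ ((a : ℝ) - 1) * (1 - t 0) ^ ((b : ℝ) - 1)) B₂.domain)
    (h₃d : B₃.domain = {t | t 0 ∈ Set.Ioo (0:ℝ) 1})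
    (h₃i : Set.EqOn B₃.integrand (fun t => (t 0) ^ ((b : ℝ) - 1) * (1 - t 0) ^ ((c : ℝ) - 1)) B₃.domain)
    (h₄d : B₄.domain = {t | t 0 ∈ Set.Ioo (0:ℝ) 1})
    (h₄i : Set.EqOn B₄.integrand (fun t => (t 0) ^ ((a : ℝ) - 1) * (1 - t 0) ^ (((b + c : ℚ) : ℝ) - 1)) B₄.domain) :
    KZ.of (B₁.graphRep Literature.ModelTheory.ExponentialFields.tarski_seidenberg_real_holds) *
        KZ.of (B₂.graphRep Literature.ModelTheory.ExponentialFields.tarski_seidenberg_real_holds) -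
      KZ.of (B₃.graphRep Literature.ModelTheory.ExponentialFields.tarski_seidenberg_real_holds) *
        KZ.of (B₄.graphRep Literature.ModelTheory.ExponentialFields.tarski_seidenberg_real_holds) ∈
      KZ.relations := by
  have h := dirichlet_pinned_mem_relations a b c B₁ B₂ B₃ B₄ h₁d h₁i h₂d h₂i h₃d h₃i h₄d h₄i
  have g₁ : of (B₁.graphRep Literature.ModelTheory.ExponentialFields.tarski_seidenberg_real_holds) - of B₁ ∈ relations :=
    (B₁.equivalent_graphRep _).symm
  have g₂ : of (B₂.graphRep Literature.ModelTheory.ExponentialFields.tarski_seidenberg_real_holds) - of B₂ ∈ relations :=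
    (B₂.equivalent_graphRep _).symm
  have g₃ : of (B₃.graphRep Literature.ModelTheory.ExponentialFields.tarski_seidenberg_real_holds) - of B₃ ∈ relations :=
    (B₃.equivalent_graphRep _).symm
  have g₄ : of (B₄.graphRep Literature.ModelTheory.ExponentialFields.tarski_seidenberg_real_holds) - of B₄ ∈ relations :=
    (B₄.equivalent_graphRep _).symm
  have h12 := mul_sub_mul_mem_relations g₁ g₂
  have h34 := mul_sub_mul_mem_relations g₃ g₄
  have key := relations.add_mem (relations.sub_mem h12 h34) h
  convert key using 1
  abel

/-- The value of a PINNED Beta representation is Euler's integral `B(p,q) = Γ(p)Γ(q)/Γ(p+q)`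
(`Selberg.integrableOn_Ioo_rpow_mul_one_sub_rpow_and_integral_eq`, transported along `ℝ¹ ≃ ℝ`). -/
theorem pinned_value (p q : ℚ) (hp : 0 < p) (hq : 0 < q) (B : KZ.IntegralRep 1)
    (hd : B.domain = {t | t 0 ∈ Set.Ioo (0:ℝ) 1})
    (hi : Set.EqOn B.integrand (fun t => (t 0) ^ ((p : ℝ) - 1) * (1 - t 0) ^ ((q : ℝ) - 1)) B.domain) :
    B.value = Real.Gamma p * Real.Gamma q / Real.Gamma (p + q) := by
  have hm : MeasurableSet B.domain := by
    rw [hd]; exact measurableSet_Ioo.preimage (measurable_pi_apply 0)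
  rw [KZ.IntegralRep.value, setIntegral_congr_fun hm hi, hd]
  have h := (MeasureTheory.volume_preserving_funUnique (Fin 1) ℝ).setIntegral_preimage_emb
    (MeasurableEquiv.funUnique (Fin 1) ℝ).measurableEmbedding
    (fun x : ℝ => x ^ ((p : ℝ) - 1) * (1 - x) ^ ((q : ℝ) - 1)) (Set.Ioo (0:ℝ) 1)
  rw [(Literature.Analysis.SpecialFunctions.Selberg.integrableOn_Ioo_rpow_mul_one_sub_rpow_and_integral_eq
    (Rat.cast_pos.mpr hp) (Rat.cast_pos.mpr hq)).2] at h
  exact h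

/-- The rational graph region of a pinned Beta representation has the same (Beta) value
(soundness of the moves, `KZ.Equivalent.value_eq_holds`). -/
theorem graphRegion_value (p q : ℚ) (hp : 0 < p) (hq : 0 < q) (B : KZ.IntegralRep 1)
    (hd : B.domain = {t | t 0 ∈ Set.Ioo (0:ℝ) 1})
    (hi : Set.EqOn B.integrand (fun t => (t 0) ^ ((p : ℝ) - 1) * (1 - t 0) ^ ((q : ℝ) - 1)) B.domain) :
    (B.graphRep Literature.ModelTheory.ExponentialFields.tarski_seidenberg_real_holds).value = Real.Gamma p * Real.Gamma q / Real.Gamma (p + q) := by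
  rw [← pinned_value p q hp hq B hd hi]
  exact (KZ.Equivalent.value_eq_holds (B.equivalent_graphRep _)).symm

/-- THE RUNG AS AN INSTANCE OF `QuadraticDescent` (`d = 3`): the two-monomial element
`x = [G₁]·[G₂] − [G₃]·[G₄]` (each `Gᵢ` KZ-rational of dimension `2 ≤ 3`, `2 + 2 ≤ 3 + 1`) is one of
the generators-built inputs of `QuadraticDescent 3`, has value `0`, and lies in EVERY `R ⊇ KZ.relations`
— with no coincidence hypothesis and no appeal to `QuadraticDescent`: this instance of the piece
(equivalently of `productDescent_of_quadraticDescent` at `d = 3`, `R = KZ.relations`) is CLOSED. -/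
theorem quadraticDescent_rung (a b c : ℚ) (B₁ B₂ B₃ B₄ : KZ.IntegralRep 1)
    (h₁d : B₁.domain = {t | t 0 ∈ Set.Ioo (0:ℝ) 1})
    (h₁i : Set.EqOn B₁.integrand (fun t => (t 0) ^ (((a + b : ℚ) : ℝ) - 1) * (1 - t 0) ^ ((c : ℝ) - 1)) B₁.domain)
    (h₂d : B₂.domain = {t | t 0 ∈ Set.Ioo (0:ℝ) 1})
    (h₂i : Set.EqOn B₂.integrand (fun t => (t 0) ^ ((a : ℝ) - 1) * (1 - t 0) ^ ((b : ℝ) - 1)) B₂.domain)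
    (h₃d : B₃.domain = {t | t 0 ∈ Set.Ioo (0:ℝ) 1})
    (h₃i : Set.EqOn B₃.integrand (fun t => (t 0) ^ ((b : ℝ) - 1) * (1 - t 0) ^ ((c : ℝ) - 1)) B₃.domain)
    (h₄d : B₄.domain = {t | t 0 ∈ Set.Ioo (0:ℝ) 1})
    (h₄i : Set.EqOn B₄.integrand (fun t => (t 0) ^ ((a : ℝ) - 1) * (1 - t 0) ^ (((b + c : ℚ) : ℝ) - 1)) B₄.domain)
    (R : AddSubgroup KZ.FormalRep) (hR : KZ.relations ≤ R) :
    let x : KZ.FormalRep :=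
      KZ.of (B₁.graphRep Literature.ModelTheory.ExponentialFields.tarski_seidenberg_real_holds) * KZ.of (B₂.graphRep Literature.ModelTheory.ExponentialFields.tarski_seidenberg_real_holds) -
        KZ.of (B₃.graphRep Literature.ModelTheory.ExponentialFields.tarski_seidenberg_real_holds) * KZ.of (B₄.graphRep Literature.ModelTheory.ExponentialFields.tarski_seidenberg_real_holds)
    (B₁.graphRep Literature.ModelTheory.ExponentialFields.tarski_seidenberg_real_holds).IsRational ∧ (B₂.graphRep Literature.ModelTheory.ExponentialFields.tarski_seidenberg_real_holds).IsRational ∧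
      (B₃.graphRep Literature.ModelTheory.ExponentialFields.tarski_seidenberg_real_holds).IsRational ∧ (B₄.graphRep Literature.ModelTheory.ExponentialFields.tarski_seidenberg_real_holds).IsRational ∧
    x ∈ AddSubgroup.closure
        ({y : KZ.FormalRep | ∃ (a b : ℕ) (s : KZ.IntegralRep a) (t : KZ.IntegralRep b),
            a ≤ 3 ∧ b ≤ 3 ∧ a + b ≤ 3 + 1 ∧ s.IsRational ∧ t.IsRational ∧ y = KZ.of s * KZ.of t} ∪
          {y : KZ.FormalRep | ∃ (k : ℕ) (u : KZ.IntegralRep k), k ≤ 3 ∧ u.IsRational ∧ y = KZ.of u}) ∧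
      KZ.eval x = 0 ∧
      (B₁.graphRep Literature.ModelTheory.ExponentialFields.tarski_seidenberg_real_holds).value * (B₂.graphRep Literature.ModelTheory.ExponentialFields.tarski_seidenberg_real_holds).value =
        (B₃.graphRep Literature.ModelTheory.ExponentialFields.tarski_seidenberg_real_holds).value * (B₄.graphRep Literature.ModelTheory.ExponentialFields.tarski_seidenberg_real_holds).value ∧
      x ∈ R := by
  intro x
  have hx : x ∈ KZ.relations :=
    dirichlet_graphRegions_mem_relations a b c B₁ B₂ B₃ B₄ h₁d h₁i h₂d h₂i h₃d h₃i h₄d h₄i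
  have hx0 : KZ.eval x = 0 := (AddMonoidHom.mem_ker).mp (KZ.relations_le_ker_eval_holds hx)
  refine ⟨KZ.IntegralRep.isRational_graphRep _ _, KZ.IntegralRep.isRational_graphRep _ _,
    KZ.IntegralRep.isRational_graphRep _ _, KZ.IntegralRep.isRational_graphRep _ _, ?_, hx0, ?_, hR hx⟩
  · refine AddSubgroup.sub_mem _ (AddSubgroup.subset_closure (Set.mem_union_left _ ?_))
      (AddSubgroup.subset_closure (Set.mem_union_left _ ?_))
    · exact ⟨1 + 1, 1 + 1, _, _, by norm_num, by norm_num, by norm_num,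
        KZ.IntegralRep.isRational_graphRep _ _, KZ.IntegralRep.isRational_graphRep _ _, rfl⟩
    · exact ⟨1 + 1, 1 + 1, _, _, by norm_num, by norm_num, by norm_num,
        KZ.IntegralRep.isRational_graphRep _ _, KZ.IntegralRep.isRational_graphRep _ _, rfl⟩
  · have h := hx0
    simp only [x, map_sub, KZ.eval_mul', KZ.eval_of] at h
    exact sub_eq_zero.mp h

/-- A SPECIMEN with pairwise distinct, non-integral Beta classes (`a = 3/2`, `b = 4/3`, `c = 5/4`):
four KZ-RATIONAL planar regions `G₁ … G₄` (polynomial integrand over a `ℚ`-semialgebraic band) with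
areas `B(17/6,5/4)`, `B(3/2,4/3)`, `B(4/3,5/4)`, `B(3/2,31/12)` and
`[G₁]·[G₂] − [G₃]·[G₄] ∈ KZ.relations`: an equality of two 4-dimensional KZ-rational volumes
`vol(G₁ × G₂) = vol(G₃ × G₄)` realised INSIDE the rules (Fubini + two changes of variables on the
4-fold product domain + four Newton–Leibniz moves), outside every proved regime of Conjecture 1
(dimension ≤ 1: Baker; polynomial boxes: rational values). -/
theorem rung_specimen :
    ∃ G₁ G₂ G₃ G₄ : KZ.IntegralRep (1 + 1),
      G₁.IsRational ∧ G₂.IsRational ∧ G₃.IsRational ∧ G₄.IsRational ∧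
      G₁.value = Real.Gamma (17 / 6) * Real.Gamma (5 / 4) / Real.Gamma (49 / 12) ∧
      G₂.value = Real.Gamma (3 / 2) * Real.Gamma (4 / 3) / Real.Gamma (17 / 6) ∧
      G₃.value = Real.Gamma (4 / 3) * Real.Gamma (5 / 4) / Real.Gamma (31 / 12) ∧
      G₄.value = Real.Gamma (3 / 2) * Real.Gamma (31 / 12) / Real.Gamma (49 / 12) ∧
      KZ.of G₁ * KZ.of G₂ - KZ.of G₃ * KZ.of G₄ ∈ KZ.relations := by
  obtain ⟨B₁, h₁d, h₁i⟩ := KZ.exists_betaRep' (3 / 2 + 4 / 3) (5 / 4) (by norm_num) (by norm_num)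
  obtain ⟨B₂, h₂d, h₂i⟩ := KZ.exists_betaRep' (3 / 2) (4 / 3) (by norm_num) (by norm_num)
  obtain ⟨B₃, h₃d, h₃i⟩ := KZ.exists_betaRep' (4 / 3) (5 / 4) (by norm_num) (by norm_num)
  obtain ⟨B₄, h₄d, h₄i⟩ := KZ.exists_betaRep' (3 / 2) (4 / 3 + 5 / 4) (by norm_num) (by norm_num)
  refine ⟨B₁.graphRep Literature.ModelTheory.ExponentialFields.tarski_seidenberg_real_holds, B₂.graphRep Literature.ModelTheory.ExponentialFields.tarski_seidenberg_real_holds, B₃.graphRep Literature.ModelTheory.ExponentialFields.tarski_seidenberg_real_holds, B₄.graphRep Literature.ModelTheory.ExponentialFields.tarski_seidenberg_real_holds,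
    KZ.IntegralRep.isRational_graphRep _ _, KZ.IntegralRep.isRational_graphRep _ _,
    KZ.IntegralRep.isRational_graphRep _ _, KZ.IntegralRep.isRational_graphRep _ _, ?_, ?_, ?_, ?_,
    dirichlet_graphRegions_mem_relations (3 / 2) (4 / 3) (5 / 4) B₁ B₂ B₃ B₄ h₁d (h₁i ▸ fun _ _ => rfl)
      h₂d (h₂i ▸ fun _ _ => rfl) h₃d (h₃i ▸ fun _ _ => rfl) h₄d (h₄i ▸ fun _ _ => rfl)⟩
  · rw [graphRegion_value (3 / 2 + 4 / 3) (5 / 4) (by norm_num) (by norm_num) B₁ h₁d (h₁i ▸ fun _ _ => rfl)]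
    push_cast; norm_num
  · rw [graphRegion_value (3 / 2) (4 / 3) (by norm_num) (by norm_num) B₂ h₂d (h₂i ▸ fun _ _ => rfl)]
    push_cast; norm_num
  · rw [graphRegion_value (4 / 3) (5 / 4) (by norm_num) (by norm_num) B₃ h₃d (h₃i ▸ fun _ _ => rfl)]
    push_cast; norm_num
  · rw [graphRegion_value (3 / 2) (4 / 3 + 5 / 4) (by norm_num) (by norm_num) B₄ h₄d (h₄i ▸ fun _ _ => rfl)]
    push_cast; norm_num


end RootDecompQuadraticDescentRung

end Summit.KontsevichZagierPeriods.KontsevichZagierPeriods.Theorems
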